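import Summits.FinalStateConjecture.FinalStateConjecture.Theses.ExactKerrEnds
import Literature.Geometry.Lorentzian.TameBreathingCurve
import Literature.Geometry.Lorentzian.ExactKerrEnd

/-!
# Disproof of `CensorshipAlongKerrEnds` — findings (cdisprove seat, crux stmt-FinalStateConjecture-18521,
# route ExactKerrEnds, rank 3; cycle 1, 2026-08-17): NO KILL, and a proof that no in-tree kill can exist
# short of a certified MGHD

Crux `C₁` (decl `Summit.FinalStateConjecture.FinalStateConjecture.Theses.ExactKerrEnds.CensorshipAlongKerrEnds`,
read back in `crux_iff`, `Iff.rfl`): for every `X`, end `e`, tame curve `F` of admissible data on `e`,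
(immersed-injective ∨ constant) [H2], admissible members [H3], Kerr-ended members off `0` [H4], tame [H1]
⟹ a tame injective immersed admissible curve `F'` with `F' 0 = F 0` whose members off `0` are
Kerr-ended AND censored (every MAXIMAL vacuum Cauchy development has complete `𝓘⁺`, sojourn form).

## Findings (every `theorem` below is sorry-free unless it sits in §6 "near misses"; there are none with sorry)

(a) LOAD-BEARING ANALYSIS.
* `withoutCensored_holds` — delete the conjunct `Censored (F' c)` from the conclusion and the statement is a
  THEOREM (immersed-injective input: `F' := F`; constant input: the breathing self-witness of the Kerr-ended
  base, `InitialDataSet.exists_tame_selfWitness` + `HasExactKerrEnd.of_eq_off_compact`). So the ENTIRE content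
  of `C₁` is the censoredness of the output members; tameness/injectivity/immersion/Kerr-endedness of the
  output are free. Consequence for disproof: NO hypothesis `H` of `C₁` admits an in-tree lemma
  `C₁_false_without_H` — see the certificate theorem.
* `not_pointwise_of_not_crux` / `exists_isMaximal_not_complete_of_not_crux` (REFUTATION CERTIFICATE): any proof
  of `¬ C₁` yields an ADMISSIBLE, KERR-ENDED datum `d` on some `X` together with a vacuum Cauchy development
  `𝒟` of `d` which is MAXIMAL (`VacuumCauchyDevelopment.IsMaximal`: every vacuum Cauchy development of `d`
  embeds into `𝒟`, Choquet-Bruhat–Geroch) and has INCOMPLETE future null infinity. Two ceilings follow.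
  IN-TREE: unconditionally `IsMaximal 𝒟` has been certified for no development of any datum; the only route
  in the tree is `Literature/…/CompleteDevelopmentMaximal.lean` (a GEODESICALLY COMPLETE vacuum Cauchy
  development is maximal as soon as some maximal development exists, i.e. modulo the undischarged CBG fact
  `choquetBruhat_geroch_exists_mghd_cauchy` = item MGHDExists 9937, XL), and it certifies CENSORED developments
  only, never a counterexample. Even granted MGHD existence abstractly, `¬ Censored d` = "the abstract MGHD of
  `d` has incomplete `𝓘⁺`", whose certification is a singularity-formation theorem reaching infinity (Penrose
  incompleteness gives an incomplete INGOING generator, compatible with complete `𝓘⁺`). So `¬ C₁` is presently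
  UNPROVABLE in the tree whatever the physics. IN PRINT: the datum must be a `C^∞`,
  complete, one-ended, DR-asymptotically-flat solution of the vacuum constraints whose MGHD has incomplete
  `𝓘⁺` — a smooth vacuum naked singularity (or other smooth AF vacuum violation of weak cosmic censorship);
  none is known: Rodnianski–Shlapentokh-Rothman (Ann. Math. 198 (2023)) / Shlapentokh-Rothman
  (arXiv:2204.09891) have `C^{1,s}` data across the cone; Shlapentokh-Rothman, C. R. Mécanique 353 (2025)
  §4.5 (2) lists smooth (even `C²`) vacuum naked-singularity formation as OPEN; Cicortas–Kehle (ARMA 250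
  (2026) §1.5): "in the smooth class, both the question of the formation of naked singularities and the
  question of their genericity remain open". Hence even the POINTWISE strengthening `PointwiseKerrEndedCensorship`
  ("every admissible Kerr-ended datum is censored"), which implies `C₁` (`crux_of_pointwise`) and is expected
  to be false, has no counterexample in print.
* `crux_iff_immInjOnly` / `not_immInjOnly_iff_not_crux` — the constant disjunct of [H2] is NOT load-bearing:
  a Kerr-ended admissible base is the base of its own Kerr-ended breathing curve (immersed, injective).
* `withoutKerrEndedHyp_iff` / `not_withoutKerrEndedHyp_iff` — dropping [H4] turns `C₁` into EXACTLY
  `C₁ ∧ E` (`E = TameEscapeToKerrEnds`, the route's rank-4 crux): [H4] is what factors the Corvino–Schoen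
  gluing problem out of `C₁`; a refutation of the [H4]-less statement may be a GLUING failure with every datum
  censored, a refutation of `C₁` never is.
* [H3] (admissibility of the members) is restated in the conclusion at `c = 0` (`F' 0 = F 0 ∈ 𝓓`), so it is
  load-bearing only trivially; an in-tree `_false_without_admissible` would need a Kerr-ended NON-admissible
  datum certified to violate the constraints (constraint evaluation on a concrete `(δ, k)` — not attempted,
  no information for provers). [H1] (tameness of the INPUT) only serves to make `F 0` a tame limit of
  Kerr-ended data; dropping it gives "good curve through every admissible base of a (merely pointwise)
  family" ⊇ `E`-type content; not refutable in-tree (same certificate).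
(b) TIGHTNESS. `pointwise_of_cruxCensoredAtZero`: asking censoredness of the output ALSO at `c = 0` is
  exactly pointwise censorship of every admissible Kerr-ended datum — the exclusion `c ≠ 0` is the whole
  distance between `C₁` and pointwise weak cosmic censorship on the Kerr-ended class.
(c) NATURAL STRENGTHENINGS, none refutable here: `PointwiseKerrEndedCensorship` (above); `e' = e` (not
  attempted: transfer of tameness between two end structures of one datum is not in the tree); straight lines
  `F 0 + c f` (constraints nonlinear — fails for silly reasons, uninformative).
(d) TARGETS: none served this cycle (payload.targets = [], stuck_stubs = []). Picked line `Sketch`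
  (transplant-the-end, `SketchIdeator1.lean`), stub signatures READ for over-strength: `LateAbsorption(At)` —
  `∀ e : AFEnd X` precedes `∃ K₀ δ`, so the arbitrary end chart is harmless (core and tolerance may depend on
  it); `δ : ℝ≥0∞` with `⊤` allowed only burdens the prover; its negation needs a non-censored admissible datum
  (certified MGHD again) — no cheap kill. `RecedingKerrGluing` — prescribed tolerances `δ c` need not tend to
  `0`, but tameness of the OUTPUT (`wDist (F' c) (F' 0) → 0`) forces the gluing radius `R(c) → ∞` anyway;
  `K₀ c = ∅` and huge `K₀ c` are both legal and both harmless (prover may agree on more; `R(c) ≥` everything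
  prescribed, locally bounded on compacts avoiding `0`); DR-admissibility of the glued exact Kerr end needs the
  unboosted quasi-isotropic leaf (translations give an `O(r⁻²)` dipole, inside `o₂(r⁻¹)`): consistent on paper.
  Its negation needs a certified obstruction to Corvino–Schoen gluing in DR weights — none known. Not attacked
  further (no targets served); `stub_windowUpgrade`/`SettledBreathing` are bookkeeping and believed true.
(e) NEAR-MISS SHAPES (what a future disprover must construct; all PROVED as implications):
  `not_crux_of_wallAccumulation` — ONE admissible Kerr-ended `d` at which, along EVERY tame admissible family
  through `d`, non-(Kerr-ended ∧ censored) members occur at parameters accumulating at `0` (NEGNOTE N3: needs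
  existence of smooth vacuum naked data near `d`, not their stability); `wallAccumulationAt_of_tameStablyNaked`
  — implied by OPEN-SET stability of non-censoredness in the weighted `C²₋₁ × C¹₋₂` end distance `AFEnd.wDist`
  (a tame-stable smooth vacuum naked singularity = the planner's kill criterion = ¬WCC). Neither hypothesis is
  constructible (see (a)), and `WallAccumulationAt` may even be TRUE at some datum while WCC holds in the
  open-dense sense — it is recorded, not filed (`--negative-modulo` is for true-but-unbuilt `H`).

## Why it resists (one paragraph for the provers)
`C₁` is bounded above by pointwise WCC on the Kerr-ended class (`crux_of_pointwise`) and its negation is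
bounded below by "a smooth admissible vacuum datum with a certified MGHD of incomplete `𝓘⁺`"
(`exists_isMaximal_not_complete_of_not_crux`). The lower bound is out of reach twice over (no smooth vacuum
naked singularity in print; no `IsMaximal` certificate in the tree), so the disprover can neither kill `C₁`
nor any of its hypothesis-deleted variants; conversely nothing here helps a PROOF except the bookkeeping:
the output's tameness/injectivity/immersion/Kerr-endedness are free (`withoutCensored_holds`), the constant
case is subsumed by the immersed case (`crux_iff_immInjOnly`), and [H4] is precisely the interface to `E`
(`withoutKerrEndedHyp_iff`). Literature searched this cycle: see NOTES.md §lit (no 2026 smooth vacuum example).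
-/

-- the doubled `FinalStateConjecture.FinalStateConjecture` path component trips dupNamespace
set_option linter.dupNamespace false

noncomputable section

open scoped Manifold ContDiff Topology
open Set Function Filter TopologicalSpace

namespace Summit.FinalStateConjecture.FinalStateConjecture.Cruxes.CensorshipAlongKerrEnds.Disproof

open Literature.Geometry.Lorentzian
open Summit.FinalStateConjecture.FinalStateConjecture.Theses.ExactKerrEnds
  (CensorshipAlongKerrEnds TameEscapeToKerrEnds)

/-! ## §1 Short forms and read-back -/
section ShortForms

variable {X : Type} [TopologicalSpace X] [ChartedSpace E3 X] [IsManifold (𝓡 3) ∞ X] [T2Space X]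
  [SecondCountableTopology X] [ConnectedSpace X]

/-- `Censored D` — every maximal vacuum Cauchy development of `D` has complete future null infinity
(sojourn form); verbatim the crux's let-bound legend. [cite: Christodoulou1999, pp. A26–A27] -/
def Censored (D : InitialDataSet (𝓡 3) X) : Prop :=
  ∀ 𝒟 : VacuumCauchyDevelopment D, 𝒟.IsMaximal →
    Summit.FinalStateConjecture.HasCompleteNullInfinity 𝒟.toCauchyDevelopment

/-- The conclusion shape of the crux at a base datum `d` (Kerr-endedness via the Literature notion
`InitialDataSet.HasExactKerrEnd`, which IS the legend, `InitialDataSet.hasExactKerrEnd_iff`). -/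
def GoodCurveThrough (d : InitialDataSet (𝓡 3) X) : Prop :=
  ∃ (e' : AFEnd X) (F' : EuclideanSpace ℝ (Fin 1) → InitialDataSet (𝓡 3) X),
    InitialDataSet.IsTameDataFamily e' 1 F' ∧ F' 0 = d ∧ Injective F' ∧
      InitialDataSet.IsImmersedAtZero 1 F' ∧ (∀ c, F' c ∈ admissibleVacuumData X) ∧
        ∀ c ≠ 0, (F' c).HasExactKerrEnd ∧ Censored (F' c)

/-- The conclusion shape with the `Censored` conjunct DELETED. -/
def KerrEndedCurveThrough (d : InitialDataSet (𝓡 3) X) : Prop :=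
  ∃ (e' : AFEnd X) (F' : EuclideanSpace ℝ (Fin 1) → InitialDataSet (𝓡 3) X),
    InitialDataSet.IsTameDataFamily e' 1 F' ∧ F' 0 = d ∧ Injective F' ∧
      InitialDataSet.IsImmersedAtZero 1 F' ∧ (∀ c, F' c ∈ admissibleVacuumData X) ∧
        ∀ c ≠ 0, (F' c).HasExactKerrEnd

omit [T2Space X] [SecondCountableTopology X] [ConnectedSpace X] in
/-- A constant curve whose members off `0` have a property has it at the base (`ℝ¹` has a non-zero
vector). [folklore] -/
theorem base_of_const {F : EuclideanSpace ℝ (Fin 1) → InitialDataSet (𝓡 3) X}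
    {Q : InitialDataSet (𝓡 3) X → Prop} (hconst : ∀ c, F c = F 0) (hQ : ∀ c ≠ 0, Q (F c)) :
    Q (F 0) := by
  have hc : (EuclideanSpace.single (0 : Fin 1) (1 : ℝ) : EuclideanSpace ℝ (Fin 1)) ≠ 0 := by
    rw [← norm_ne_zero_iff, PiLp.norm_single, norm_one]
    exact one_ne_zero
  rw [← hconst (EuclideanSpace.single (0 : Fin 1) (1 : ℝ))]
  exact hQ _ hc

/-- **Kerr-ended self-witness.** Through every admissible Kerr-ended datum passes a tame, injective,
immersed curve of admissible KERR-ENDED data (its breathing curve: members agree with `d` off one compact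
set, `InitialDataSet.exists_tame_selfWitness`; Kerr-endedness is stable under modification on a compact
set, `HasExactKerrEnd.of_eq_off_compact`). No censoredness is claimed or needed. [folklore] -/
theorem kerrEndedCurveThrough_of_hasExactKerrEnd {d : InitialDataSet (𝓡 3) X}
    (hd : d ∈ admissibleVacuumData X) (hKE : d.HasExactKerrEnd) : KerrEndedCurveThrough d := by
  obtain ⟨e', F', hF', himm', h0', hinj', h𝓓', K, hK, hagree⟩ :=
    InitialDataSet.exists_tame_selfWitness hd
  exact ⟨e', F', hF', h0', hinj', himm', h𝓓', fun c _ ↦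
    hKE.of_eq_off_compact hK (fun x hx ↦ (hagree c x hx).1) fun x hx ↦ (hagree c x hx).2⟩

omit [T2Space X] [SecondCountableTopology X] [ConnectedSpace X] in
/-- A constant curve at an admissible datum is tame on the datum's sole end. [folklore] -/
theorem isTameDataFamily_const_of_mem {d : InitialDataSet (𝓡 3) X} (hd : d ∈ admissibleVacuumData X) :
    ∃ e : AFEnd X, InitialDataSet.IsTameDataFamily e 1 (fun _ : EuclideanSpace ℝ (Fin 1) ↦ d) := by
  obtain ⟨-, e, M, hsole, hdecay⟩ := id hd
  exact ⟨e, InitialDataSet.isTameDataFamily_const hsole 1 hdecay⟩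

end ShortForms

/-- **Read-back.** The crux IS: for every `X`, end `e` and tame curve `F` of admissible data on `e`,
immersed-injective or constant, with Kerr-ended members off `0`, there is a good curve through `F 0`
(definitional: `InitialDataSet.HasExactKerrEnd` unfolds verbatim to the legend). [folklore] -/
theorem crux_iff :
    CensorshipAlongKerrEnds ↔
      ∀ (X : Type) [TopologicalSpace X] [ChartedSpace E3 X] [IsManifold (𝓡 3) ∞ X] [T2Space X]
        [SecondCountableTopology X] [ConnectedSpace X],
        ∀ (e : AFEnd X) (F : EuclideanSpace ℝ (Fin 1) → InitialDataSet (𝓡 3) X),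
          InitialDataSet.IsTameDataFamily e 1 F →
            ((InitialDataSet.IsImmersedAtZero 1 F ∧ Injective F) ∨ ∀ c, F c = F 0) →
              (∀ c, F c ∈ admissibleVacuumData X) → (∀ c ≠ 0, (F c).HasExactKerrEnd) →
                GoodCurveThrough (F 0) :=
  Iff.rfl

/-! ## §2 (a) Load-bearing analysis -/

/-- `C₁` with the conjunct `Censored (F' c)` DELETED from the conclusion. -/
def WithoutCensored : Prop :=
  ∀ (X : Type) [TopologicalSpace X] [ChartedSpace E3 X] [IsManifold (𝓡 3) ∞ X] [T2Space X]
    [SecondCountableTopology X] [ConnectedSpace X],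
    ∀ (e : AFEnd X) (F : EuclideanSpace ℝ (Fin 1) → InitialDataSet (𝓡 3) X),
      InitialDataSet.IsTameDataFamily e 1 F →
        ((InitialDataSet.IsImmersedAtZero 1 F ∧ Injective F) ∨ ∀ c, F c = F 0) →
          (∀ c, F c ∈ admissibleVacuumData X) → (∀ c ≠ 0, (F c).HasExactKerrEnd) →
            KerrEndedCurveThrough (F 0)

/-- **(a1) The `Censored` conjunct carries ALL the content: `C₁` minus `Censored` is a theorem.**
Immersed-injective input: the input curve itself; constant input: the base is Kerr-ended
(`base_of_const`) and its breathing self-witness is a Kerr-ended curve through it. Hence every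
refutation of `C₁` must refute censoredness of some member, never tameness / injectivity / immersion /
admissibility / Kerr-endedness of an output. [folklore] -/
theorem withoutCensored_holds : WithoutCensored := by
  intro X _ _ _ _ _ _ e F hF hdich h𝓓 hKE
  rcases hdich with ⟨himm, hinj⟩ | hconst
  · exact ⟨e, F, hF, rfl, hinj, himm, h𝓓, hKE⟩
  · exact kerrEndedCurveThrough_of_hasExactKerrEnd (h𝓓 0) (base_of_const hconst hKE)

/-- The POINTWISE strengthening: every admissible Kerr-ended datum is censored (weak cosmic censorship,
pointwise, on the Kerr-ended class — expected FALSE, but see the module docstring: no smooth vacuum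
counterexample exists in print). [cite: Christodoulou1999, p. A24] -/
def PointwiseKerrEndedCensorship : Prop :=
  ∀ (X : Type) [TopologicalSpace X] [ChartedSpace E3 X] [IsManifold (𝓡 3) ∞ X] [T2Space X]
    [SecondCountableTopology X] [ConnectedSpace X],
    ∀ d ∈ admissibleVacuumData X, d.HasExactKerrEnd → Censored d

/-- **`C₁` is bounded above by pointwise censorship of Kerr-ended admissible data** (the prover's
`censorshipAlongKerrEnds_of_pointwise`, re-proved here without any censored-transport lemma: the members of
the Kerr-ended self-witness are themselves admissible and Kerr-ended, so the pointwise hypothesis applies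
to each). [folklore] -/
theorem crux_of_pointwise (h : PointwiseKerrEndedCensorship) : CensorshipAlongKerrEnds := by
  rw [crux_iff]
  intro X _ _ _ _ _ _ e F hF hdich h𝓓 hKE
  obtain ⟨e', F', hF', h0', hinj', himm', h𝓓', hKE'⟩ := withoutCensored_holds X e F hF hdich h𝓓 hKE
  exact ⟨e', F', hF', h0', hinj', himm', h𝓓', fun c hc ↦
    ⟨hKE' c hc, h X (F' c) (h𝓓' c) (hKE' c hc)⟩⟩

/-- **(a2) Contrapositive: a refutation of `C₁` refutes pointwise censorship on the Kerr-ended class.**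
[folklore] -/
theorem not_pointwise_of_not_crux (h : ¬ CensorshipAlongKerrEnds) : ¬ PointwiseKerrEndedCensorship :=
  fun hp ↦ h (crux_of_pointwise hp)

/-- **(a2') REFUTATION CERTIFICATE.** Any proof of `¬ C₁` produces an admissible, Kerr-ended datum `d` on
some `3`-manifold `X` and a vacuum Cauchy development `𝒟` of `d` which is MAXIMAL (every vacuum Cauchy
development of `d` embeds into it) and whose future null infinity is INCOMPLETE. In the current tree no
development of any datum carries an `IsMaximal` certificate (Choquet-Bruhat–Geroch is an undischarged
fact), so `¬ C₁` is at present unprovable in the tree; in print no `C^∞` admissible vacuum datum with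
incomplete `𝓘⁺` is known (Shlapentokh-Rothman 2025, §4.5 (2)).
[cite: ChoquetBruhatGeroch1969CMP, Theorem p. 331] [cite: Sbierski2016AHP, Thm. 2.6] -/
theorem exists_isMaximal_not_complete_of_not_crux (h : ¬ CensorshipAlongKerrEnds) :
    ∃ (X : Type) (_ : TopologicalSpace X) (_ : ChartedSpace E3 X) (_ : IsManifold (𝓡 3) ∞ X)
      (_ : T2Space X) (_ : SecondCountableTopology X) (_ : ConnectedSpace X)
      (d : InitialDataSet (𝓡 3) X), d ∈ admissibleVacuumData X ∧ d.HasExactKerrEnd ∧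
        ∃ 𝒟 : VacuumCauchyDevelopment d, 𝒟.IsMaximal ∧
          ¬ Summit.FinalStateConjecture.HasCompleteNullInfinity 𝒟.toCauchyDevelopment := by
  by_contra hno
  refine h (crux_of_pointwise fun X _ _ _ _ _ _ d hd hKE 𝒟 h𝒟 ↦ ?_)
  by_contra hinc
  exact hno ⟨X, inferInstance, inferInstance, inferInstance, inferInstance, inferInstance,
    inferInstance, d, hd, hKE, 𝒟, h𝒟, hinc⟩

/-- `C₁` restricted to IMMERSED-INJECTIVE inputs (the constant disjunct of [H2] dropped). -/
def ImmInjOnly : Prop :=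
  ∀ (X : Type) [TopologicalSpace X] [ChartedSpace E3 X] [IsManifold (𝓡 3) ∞ X] [T2Space X]
    [SecondCountableTopology X] [ConnectedSpace X],
    ∀ (e : AFEnd X) (F : EuclideanSpace ℝ (Fin 1) → InitialDataSet (𝓡 3) X),
      InitialDataSet.IsTameDataFamily e 1 F → InitialDataSet.IsImmersedAtZero 1 F → Injective F →
        (∀ c, F c ∈ admissibleVacuumData X) → (∀ c ≠ 0, (F c).HasExactKerrEnd) →
          GoodCurveThrough (F 0)

/-- **(a3) The constant disjunct of [H2] is NOT load-bearing**: `C₁ ↔` its immersed-injective case. A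
constant admissible curve with Kerr-ended members off `0` has a Kerr-ended base, which is the base of its
own Kerr-ended breathing curve (immersed, injective, admissible), to which the immersed case applies.
[folklore] -/
theorem crux_iff_immInjOnly : CensorshipAlongKerrEnds ↔ ImmInjOnly := by
  rw [crux_iff]
  refine ⟨fun h X _ _ _ _ _ _ e F hF himm hinj h𝓓 hKE ↦ h X e F hF (Or.inl ⟨himm, hinj⟩) h𝓓 hKE,
    fun h X _ _ _ _ _ _ e F hF hdich h𝓓 hKE ↦ ?_⟩
  rcases hdich with ⟨himm, hinj⟩ | hconst
  · exact h X e F hF himm hinj h𝓓 hKE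
  · obtain ⟨e', F', hF', h0', hinj', himm', h𝓓', hKE'⟩ :=
      kerrEndedCurveThrough_of_hasExactKerrEnd (h𝓓 0) (base_of_const hconst hKE)
    rw [← h0']
    exact h X e' F' hF' himm' hinj' h𝓓' hKE'

/-- (a3, negative form) A refutation of `C₁` is always a refutation of its immersed-injective case.
[folklore] -/
theorem not_immInjOnly_iff_not_crux : ¬ ImmInjOnly ↔ ¬ CensorshipAlongKerrEnds :=
  not_congr crux_iff_immInjOnly.symm

/-- `C₁` with hypothesis [H4] (`∀ c ≠ 0, KerrEnded (F c)`) DROPPED. -/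
def WithoutKerrEndedHyp : Prop :=
  ∀ (X : Type) [TopologicalSpace X] [ChartedSpace E3 X] [IsManifold (𝓡 3) ∞ X] [T2Space X]
    [SecondCountableTopology X] [ConnectedSpace X],
    ∀ (e : AFEnd X) (F : EuclideanSpace ℝ (Fin 1) → InitialDataSet (𝓡 3) X),
      InitialDataSet.IsTameDataFamily e 1 F →
        ((InitialDataSet.IsImmersedAtZero 1 F ∧ Injective F) ∨ ∀ c, F c = F 0) →
          (∀ c, F c ∈ admissibleVacuumData X) → GoodCurveThrough (F 0)

/-- Without [H4] the statement is "a good curve through EVERY admissible datum" (constant curves are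
tame on the sole end). [folklore] -/
theorem withoutKerrEndedHyp_iff_forall :
    WithoutKerrEndedHyp ↔
      ∀ (X : Type) [TopologicalSpace X] [ChartedSpace E3 X] [IsManifold (𝓡 3) ∞ X] [T2Space X]
        [SecondCountableTopology X] [ConnectedSpace X],
        ∀ d ∈ admissibleVacuumData X, GoodCurveThrough d := by
  refine ⟨fun h X _ _ _ _ _ _ d hd ↦ ?_, fun h X _ _ _ _ _ _ e F _ _ h𝓓 ↦ h X (F 0) (h𝓓 0)⟩
  obtain ⟨e, he⟩ := isTameDataFamily_const_of_mem hd
  exact h X e (fun _ ↦ d) he (Or.inr fun _ ↦ rfl) fun _ ↦ hd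

/-- **(a4) [H4] is exactly the interface to the gluing crux `E`: dropping it gives `C₁ ∧ E`**
(`E = TameEscapeToKerrEnds`: Kerr-endedness is tame-generic). `→`: a good curve through every admissible
datum is in particular a censored escape (`C₁`) and a Kerr-ended escape (`E`). `←`: at a Kerr-ended base
feed `C₁` the constant curve; at a non-Kerr-ended base feed it the Kerr-ended tame escape supplied by `E`.
So a refutation of the [H4]-less statement may be a pure GLUING obstruction with every datum censored,
whereas a refutation of `C₁` is always a censorship failure (`exists_isMaximal_not_complete_of_not_crux`).
[folklore] -/
theorem withoutKerrEndedHyp_iff :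
    WithoutKerrEndedHyp ↔ CensorshipAlongKerrEnds ∧ TameEscapeToKerrEnds := by
  rw [withoutKerrEndedHyp_iff_forall, crux_iff]
  refine ⟨fun h ↦ ⟨fun X _ _ _ _ _ _ e F _ _ h𝓓 _ ↦ h X (F 0) (h𝓓 0), fun X _ _ _ _ _ _ d hd ↦ ?_⟩,
    fun ⟨hC, hE⟩ X _ _ _ _ _ _ d hd ↦ ?_⟩
  · -- `E` from good curves: members off `0` are admissible and Kerr-ended, hence not exceptional
    obtain ⟨e', F', hF', h0', hinj', himm', h𝓓', hgood⟩ := h X d hd.1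
    exact ⟨e', F', hF', himm', h0', hinj', h𝓓', fun c hc hmem ↦ hmem.2 (hgood c hc).1⟩
  · by_cases hKE : d.HasExactKerrEnd
    · obtain ⟨e, he⟩ := isTameDataFamily_const_of_mem hd
      exact hC X e (fun _ ↦ d) he (Or.inr fun _ ↦ rfl) (fun _ ↦ hd) fun _ _ ↦ hKE
    · obtain ⟨e, F, hF, himm, h0, hinj, h𝓓, hesc⟩ := hE X d ⟨hd, hKE⟩
      have hKE' : ∀ c ≠ 0, (F c).HasExactKerrEnd := fun c hc ↦ by
        by_contra hn
        exact hesc c hc ⟨h𝓓 c, hn⟩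
      rw [← h0]
      exact hC X e F hF (Or.inl ⟨himm, hinj⟩) h𝓓 hKE'

/-- (a4, negative form) The failure modes of the [H4]-less statement are exactly those of `C₁` together
with those of `E`. [folklore] -/
theorem not_withoutKerrEndedHyp_iff :
    ¬ WithoutKerrEndedHyp ↔ ¬ CensorshipAlongKerrEnds ∨ ¬ TameEscapeToKerrEnds := by
  rw [withoutKerrEndedHyp_iff, not_and_or]

/-! ## §3 (b) Tightness of `c ≠ 0` -/

/-- The strengthening of `C₁` asking censoredness of the output members for ALL `c`, base included. -/
def CruxCensoredAtZero : Prop :=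
  ∀ (X : Type) [TopologicalSpace X] [ChartedSpace E3 X] [IsManifold (𝓡 3) ∞ X] [T2Space X]
    [SecondCountableTopology X] [ConnectedSpace X],
    ∀ (e : AFEnd X) (F : EuclideanSpace ℝ (Fin 1) → InitialDataSet (𝓡 3) X),
      InitialDataSet.IsTameDataFamily e 1 F →
        ((InitialDataSet.IsImmersedAtZero 1 F ∧ Injective F) ∨ ∀ c, F c = F 0) →
          (∀ c, F c ∈ admissibleVacuumData X) → (∀ c ≠ 0, (F c).HasExactKerrEnd) →
            ∃ (e' : AFEnd X) (F' : EuclideanSpace ℝ (Fin 1) → InitialDataSet (𝓡 3) X),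
              InitialDataSet.IsTameDataFamily e' 1 F' ∧ F' 0 = F 0 ∧ Injective F' ∧
                InitialDataSet.IsImmersedAtZero 1 F' ∧ (∀ c, F' c ∈ admissibleVacuumData X) ∧
                  (∀ c ≠ 0, (F' c).HasExactKerrEnd) ∧ ∀ c, Censored (F' c)

/-- **(b) The exclusion `c ≠ 0` is tight up to pointwise WCC**: censoredness also at `c = 0` forces every
admissible Kerr-ended datum to be censored (feed the constant curve: `F' 0 = d`). Conversely
`PointwiseKerrEndedCensorship` + censoredness of tame limits of Kerr-ended data would give it back; so the
`c ≠ 0` is precisely what keeps `C₁` a positive-codimension statement. [folklore] -/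
theorem pointwise_of_cruxCensoredAtZero (h : CruxCensoredAtZero) : PointwiseKerrEndedCensorship := by
  intro X _ _ _ _ _ _ d hd hKE
  obtain ⟨e, he⟩ := isTameDataFamily_const_of_mem hd
  obtain ⟨e', F', -, h0', -, -, -, -, hC⟩ :=
    h X e (fun _ ↦ d) he (Or.inr fun _ ↦ rfl) (fun _ ↦ hd) fun _ _ ↦ hKE
  rw [← h0']
  exact hC 0

/-! ## §6 (e) Near-miss shapes: the counterexample a future disprover must build -/
section NearMiss

variable {X : Type} [TopologicalSpace X] [ChartedSpace E3 X] [IsManifold (𝓡 3) ∞ X] [T2Space X]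
  [SecondCountableTopology X] [ConnectedSpace X]

/-- **Wall accumulation at `d`** (NEGNOTE-ideator1 N3): along EVERY one-parameter family of admissible data
through `d` which is tame on some end, members that fail to be (Kerr-ended and censored) occur at non-zero
parameters of arbitrarily small norm. -/
def WallAccumulationAt (d : InitialDataSet (𝓡 3) X) : Prop :=
  ∀ (e' : AFEnd X) (F' : EuclideanSpace ℝ (Fin 1) → InitialDataSet (𝓡 3) X),
    InitialDataSet.IsTameDataFamily e' 1 F' → F' 0 = d → (∀ c, F' c ∈ admissibleVacuumData X) →
      ∀ ε > (0 : ℝ), ∃ c, c ≠ 0 ∧ ‖c‖ < ε ∧ ((F' c).HasExactKerrEnd → ¬ Censored (F' c))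

/-- **Tame-stable nakedness at `d`** (the planner's kill criterion "a smooth Kerr-ended vacuum datum forming
a naked singularity STABLY under tame perturbations"): for some `ε > 0`, every admissible datum within
weighted `C²₋₁ × C¹₋₂` distance `ε` of `d` (`AFEnd.wDist`, `ℝ≥0∞`-valued) on any end on which `d` is
Dafermos–Rodnianski flat is NOT censored. Physically: an open set of counterexamples to weak cosmic
censorship around `d`. -/
def TameStablyNakedAt (d : InitialDataSet (𝓡 3) X) : Prop :=
  ∃ ε > (0 : ENNReal), ∀ (e : AFEnd X) (M : ℝ), e.IsStronglyAsymptoticallyFlatDR d M →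
    ∀ D ∈ admissibleVacuumData X, e.wDist D d < ε → ¬ Censored D

/-- **Wall accumulation at one admissible Kerr-ended datum refutes `C₁`** (feed the constant curve at `d`;
the good curve returned is a tame admissible family through `d` all of whose members off `0` are Kerr-ended
and censored, contradicting accumulation at `ε = 1`). The hypothesis is not constructible: it needs smooth
admissible vacuum data with a certified maximal development of incomplete `𝓘⁺` near `d`. [folklore] -/
theorem not_crux_of_wallAccumulationAt {d : InitialDataSet (𝓡 3) X} (hd : d ∈ admissibleVacuumData X)
    (hKE : d.HasExactKerrEnd) (hW : WallAccumulationAt d) : ¬ CensorshipAlongKerrEnds := by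
  intro hC
  rw [crux_iff] at hC
  obtain ⟨e, he⟩ := isTameDataFamily_const_of_mem hd
  obtain ⟨e', F', hF', h0', -, -, h𝓓', hgood⟩ :=
    hC X e (fun _ ↦ d) he (Or.inr fun _ ↦ rfl) (fun _ ↦ hd) fun _ _ ↦ hKE
  obtain ⟨c, hc, -, hbad⟩ := hW e' F' hF' h0' h𝓓' 1 one_pos
  exact hbad (hgood c hc).1 (hgood c hc).2

omit [T2Space X] [SecondCountableTopology X] in
/-- **Tame-stable nakedness implies wall accumulation** (a tame family is `wDist`-continuous at `0` on its
end, on which its base is Dafermos–Rodnianski flat, so its small members lie in the naked ball).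
[folklore] -/
theorem wallAccumulationAt_of_tameStablyNaked {d : InitialDataSet (𝓡 3) X} (h : TameStablyNakedAt d) :
    WallAccumulationAt d := by
  obtain ⟨ε, hε, hnaked⟩ := h
  intro e' F' hF' h0' h𝓓' δ hδ
  obtain ⟨_, _, ⟨M, -, hM⟩, htend⟩ := hF'
  -- small members are `wDist`-close to the base
  have hev : ∀ᶠ c in 𝓝 (0 : EuclideanSpace ℝ (Fin 1)), e'.wDist (F' c) (F' 0) < ε :=
    htend (Iio_mem_nhds hε)
  obtain ⟨ρ, hρ, hball⟩ := Metric.eventually_nhds_iff.1 hev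
  -- a non-zero parameter of norm below `min ρ δ`
  set t : ℝ := min ρ δ / 2 with ht
  have htpos : 0 < t := by positivity
  set c : EuclideanSpace ℝ (Fin 1) := EuclideanSpace.single (0 : Fin 1) t with hcdef
  have hcn : ‖c‖ = t := by
    rw [hcdef, PiLp.norm_single, Real.norm_of_nonneg htpos.le]
  refine ⟨c, ?_, ?_, fun _ ↦ ?_⟩
  · rw [← norm_ne_zero_iff, hcn]
    exact htpos.ne'
  · rw [hcn, ht]
    have := min_le_right ρ δ
    linarith
  · have hdist : dist c 0 < ρ := by
      rw [dist_zero_right, hcn, ht]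
      have := min_le_left ρ δ
      linarith
    have hw : e'.wDist (F' c) d < ε := by
      rw [← h0']
      exact hball hdist
    have hM0 : e'.IsStronglyAsymptoticallyFlatDR d (M 0) := by
      rw [← h0']
      exact hM 0
    exact hnaked e' (M 0) hM0 (F' c) (h𝓓' c) hw

/-- **A tame-stably naked admissible Kerr-ended datum refutes `C₁`** (the planner's kill criterion, as a
kernel-checked implication; its hypothesis is an open set of smooth vacuum counterexamples to weak cosmic
censorship — conjecturally EMPTY, and in any case not constructible in the tree). [folklore] -/
theorem not_crux_of_tameStablyNakedAt {d : InitialDataSet (𝓡 3) X} (hd : d ∈ admissibleVacuumData X)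
    (hKE : d.HasExactKerrEnd) (h : TameStablyNakedAt d) : ¬ CensorshipAlongKerrEnds :=
  not_crux_of_wallAccumulationAt hd hKE (wallAccumulationAt_of_tameStablyNaked h)

end NearMiss

end Summit.FinalStateConjecture.FinalStateConjecture.Cruxes.CensorshipAlongKerrEnds.Disproof

end
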